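import Summits.HodgeConjecture.HodgeConjecture.Theorems.Ring2AbelianAllAndreBaseCurveCorrespondences
import HarnessLib

/-!
# Ring 2 · sub-cell AbelianAll (ALL ABELIAN VARIETIES), André axis, part XVII-c — THE CURVE NO-GO IN LINEAR FORM:
# a correspondence over a curve of `S × S` satisfies `j_s^* ∘ T ∘ L_t = 0`, and a SUM of such correspondences (over
# different parameter spaces and curves) is still never a witness of the fibre-class Lefschetz node (β′_f)

HONEST FRAMING (page 1, verbatim): **research route, not a corollary; conditional on HC_CM plus one named
minimal statement.** Cell line: research route conditional on HC_CM; not a corollary; Q11.4-sentence-2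
already refuted in dim ≥ 3. Nothing in this file proves a case of the Hodge conjecture for an abelian variety.
`HC_CM` = `Theses.RankFourFaces.CMAbelianHodge` does not occur in this file; item `Theses.RankFourFaces.CMToAbelian`
(stmt-16267) OPEN and not closed here. Seat `pub-hodge-ring2-ab-andre-2`, gen 9; serves REFEREE-AB R-22 finding
F-ab-68 on part XVI-d (p212631): "the sentence 'a witness written as a sum of push-forwards has a component whose
base pair does not factor through a curve' is a valid deduction only because each excluded class satisfies the
LINEAR identity `j_s^* ∘ T ∘ L_t = 0`; recommend one kernel lemma … so the sum step is by name".

## What is proved (theorems only; no definition, no named fact, no sorry; every input a tree theorem)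

Notation of part XVI-d: `f : 𝒳 ⟶ S` a compact pencil of abelian `d`-folds, `W` smooth projective of dimension `m`,
`a, b : W ⟶ 𝒳`, `w ∈ H^q(W(ℂ); ℂ)`, `μ` an orientation family with Poincaré duality, `γ = (a, b)_* w ∈
H^{2e}((𝒳 ⊗ 𝒳)(ℂ); ℂ)`, `T = γ^*` in degrees `2p + 2 → 2p`, `L_t = j_{t*} j_t^*`.

§1 The `= 0` forms of part XVI-d §2 / §4 / §5:
* `map_fiberι_corrClassAction_lift_eq_zero_of_map_fst_fiberClass_eq_zero` — `a^*[𝒳_{t₀}] = 0 ⟹ j_s^*(T c) = 0`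
  for EVERY class `c` (first-vertical: `j_s^* ∘ T = 0`);
* `map_fiberι_corrClassAction_fiberGysin_eq_zero_of_map_fiberClass_propor` — `b^*[𝒳_{t₀}] = c · a^*[𝒳_{t₀}] ⟹
  j_s^*(T(L_t W')) = 0` (proportionally balanced, part XV-d's `…_of_balanced'` with `G = c · [𝒳_{t₀}]`);
* **`map_fiberι_corrClassAction_fiberGysin_eq_zero_of_factor_curve` — if the base pair `(a ≫ f, b ≫ f)` factors
  through a smooth projective CURVE then `j_s^*(T(L_t W')) = 0` for all `W'`, `t`, `s`** (the lemma F-ab-68 asks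
  for; part XVI-d's `not_fibreClassLefschetz_clause_of_factor_curve` is its corollary).

§2 The sum step, by name:
* `not_fibreClassLefschetz_clause_of_forall_eq_zero` — ANY class `γ` on `𝒳 × 𝒳` with `j_s^* γ^* L_t = 0`
  identically is not a witness of a clause `p ≤ d` (`j_{t}^* ≠ 0` on `H²ᵖ(𝒳)`, part XV-a);
* `map_fiberι_corrClassAction_fiberGysin_sum_eq_zero` — the identity `j_s^* γ^* L_t = 0` is LINEAR in `γ`: it passes
  to finite sums (`corrClassAction` is linear in the correspondence);
* **`not_fibreClassLefschetz_clause_of_sum_factor_curve` — a finite SUM `γ = Σᵢ (aᵢ, bᵢ)_* wᵢ` of push-forward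
  classes from smooth projective `Wᵢ` (any dimensions, any degrees `qᵢ` landing in `2e`) whose base pairs
  `(aᵢ ≫ f, bᵢ ≫ f)` each factor through a smooth projective curve `Cᵢ` is NEVER a witness of a clause `p ≤ d` of
  (β′_f).** Hence (READING of part XVI-d, now by name): an algebraic witness, written as a sum of push-forwards from
  resolutions of the components of a cycle on `𝒳 × 𝒳`, has at least one component whose base pair does not factor
  through any smooth projective curve.

No named fact; no Hodge-conjecture input; `HC_CM` does not occur.

References: VoisinHodgeII2003 (proof of Thm. 10.17 (10.7)); FultonYoungTableaux1997 (App. B §B.1 (2), (4)–(6));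
Fulton1998 (§19.1 Prop. 19.1.1, Example 10.3.2); Abdulali1994FamiliesAV (Conj. 5.3, Thm. 5.5 p. 1130);
DeligneHodgeII1971 (Thm. 4.1.1); Andre1996Motifs (§2.1 p. 14, Prop. 3.3 p. 21).
-/

noncomputable section

set_option linter.dupNamespace false

namespace Summit.HodgeConjecture.HodgeConjecture.Ring2.AbelianAll

open CategoryTheory AlgebraicGeometry MonoidalCategory CartesianMonoidalCategory
open Literature.AlgebraicGeometry Literature.AlgebraicGeometry.Motives
open Literature.AlgebraicGeometry.HodgeTheory
open Literature.AlgebraicTopology.SingularHomology (singularCohomology cupProduct HomologicalOrientation)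

variable {𝒳 S : SchemeOver ℂ} {m : ℕ} {W : SchemeOver ℂ}

/-! ## §1 The `= 0` forms -/

/-- **First-vertical, linear form: `a^*[𝒳_{t₀}] = 0 ⟹ j_s^* ∘ T = 0`** for `T = [(a, b)_* w]^*` (`T c = a_*(b^* c ∪ w)`,
part XVI-d §1, and `j_s^* ∘ a_* = 0`, part XVI-d §2). [cite: VoisinHodgeII2003, proof of Thm. 10.17 (10.7)]
[cite: DeligneHodgeII1971, Thm. 4.1.1] -/
theorem map_fiberι_corrClassAction_lift_eq_zero_of_map_fst_fiberClass_eq_zero {d : ℕ} {f : 𝒳 ⟶ S}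
    (hf : IsCompactAbelianPencil f d) (hW : IsSmoothProjective m W) (a b : W ⟶ 𝒳) (μ : OrientationFamily)
    (hμ : μ.HasPoincareDuality) {q e : ℕ} (hqe : q + 2 * ((d + 1) + (d + 1)) = 2 * e + 2 * m)
    (w : complexBetti W q) {t₀ : ComplexPoints S}
    (ha0 : complexBetti.map a (2 * (0 + 1))
      (fiberGysin hf t₀ 0 (singularCohomology.one ℂ (ComplexPoints (fiberOver f t₀)))) = 0)
    {p q' : ℕ} (hpe : 2 * (p + 1) + 2 * e = 2 * p + 2 * (d + 1)) (hq' : 2 * p + q' = 2 * (d + 1))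
    (c : complexBetti 𝒳 (2 * (p + 1))) (s : ComplexPoints S) :
    complexBetti.map (fiberι f s) (2 * p)
      (corrClassAction (μ (hf.isSmoothProjective_total.tensor_holds hf.isSmoothProjective_total))
        (μ hf.isSmoothProjective_total) hpe hq'
        (complexGysin μ hW (hf.isSmoothProjective_total.tensor_holds hf.isSmoothProjective_total) (lift a b) hqe w)
        c) = 0 := by
  have h𝒳 := hf.isSmoothProjective_total
  rw [corrClassAction_complexGysin_lift μ hμ hW h𝒳 (h𝒳.tensor_holds h𝒳) a b hqe hpe hq'
    (show 2 * (p + 1) + q + 2 * (d + 1) = 2 * p + 2 * m by omega)]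
  exact map_fiberι_complexGysin_eq_zero_of_map_fiberClass_eq_zero hf hW a μ hμ ha0 _ _ s

/-- **Proportional fibre classes, linear form: `b^*[𝒳_{t₀}] = c · a^*[𝒳_{t₀}] ⟹ j_s^*(T(L_t W')) = 0`** (the
correspondence is balanced up to the fibre-killed class `c · [𝒳_{t₀}]`, part XV-d).
[cite: Fulton1998, Example 10.3.2] [cite: VoisinHodgeII2003, proof of Thm. 10.17 (10.7)] -/
theorem map_fiberι_corrClassAction_fiberGysin_eq_zero_of_map_fiberClass_propor {d : ℕ} {f : 𝒳 ⟶ S}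
    (hf : IsCompactAbelianPencil f d) (hW : IsSmoothProjective m W) (a b : W ⟶ 𝒳) (μ : OrientationFamily)
    (hμ : μ.HasPoincareDuality) {q e : ℕ} (hqe : q + 2 * ((d + 1) + (d + 1)) = 2 * e + 2 * m)
    (w : complexBetti W q) {t₀ : ComplexPoints S} {c : ℂ}
    (hc : complexBetti.map b (2 * (0 + 1))
        (fiberGysin hf t₀ 0 (singularCohomology.one ℂ (ComplexPoints (fiberOver f t₀)))) =
      c • complexBetti.map a (2 * (0 + 1))
        (fiberGysin hf t₀ 0 (singularCohomology.one ℂ (ComplexPoints (fiberOver f t₀)))))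
    {p q' : ℕ} (hpe : 2 * (p + 1) + 2 * e = 2 * p + 2 * (d + 1)) (hq' : 2 * p + q' = 2 * (d + 1))
    (W' : complexBetti 𝒳 (2 * p)) (t s : ComplexPoints S) :
    complexBetti.map (fiberι f s) (2 * p)
      (corrClassAction (μ (hf.isSmoothProjective_total.tensor_holds hf.isSmoothProjective_total))
        (μ hf.isSmoothProjective_total) hpe hq'
        (complexGysin μ hW (hf.isSmoothProjective_total.tensor_holds hf.isSmoothProjective_total) (lift a b) hqe w)
        (fiberGysin hf t p (complexBetti.map (fiberι f t) (2 * p) W'))) = 0 :=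
  map_fiberι_corrClassAction_fiberGysin_eq_zero_of_balanced' hf _ _ (hμ hf.isSmoothProjective_total) hpe hq' _ t₀
    (c • fiberGysin hf t₀ 0 (singularCohomology.one ℂ (ComplexPoints (fiberOver f t₀))))
    (fun s ↦ by rw [map_smul, map_fiberι_fiberGysin_one_eq_zero hf t₀ s, smul_zero])
    (by rw [cupProduct_complexGysin_lift_snd_eq_smul hf hW a b μ hμ hqe w hc, map_smul, map_smul]) W' t s

/-- **THE CURVE NO-GO IN LINEAR FORM (F-ab-68).** If the base pair `(a ≫ f, b ≫ f) : W → S × S` factors through a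
smooth projective curve `C` (`a ≫ f = g ≫ u`, `b ≫ f = g ≫ v`), then for `T = [(a, b)_* w]^*`:
**`j_s^*(T(j_{t*} j_t^* W')) = 0` for all `W'`, `t`, `s`.** (`[𝒳_t] = f^* σ`, part XVI-c; `u^* σ`, `v^* σ` lie in the
line `H²(C)`: either `u^* σ = 0` — first-vertical — or `v^* σ = c · u^* σ` — proportional.)
[cite: Abdulali1994FamiliesAV, Conjecture 5.3 and Theorem 5.5 (p. 1130)] [cite: Fulton1998, §19.1 Prop. 19.1.1 and Example 10.3.2] -/
theorem map_fiberι_corrClassAction_fiberGysin_eq_zero_of_factor_curve {d : ℕ} {f : 𝒳 ⟶ S}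
    (hf : IsCompactAbelianPencil f d) (hW : IsSmoothProjective m W) (a b : W ⟶ 𝒳) {C : SchemeOver ℂ}
    (hC : IsSmoothProjective 1 C) (g : W ⟶ C) (u v : C ⟶ S) (hau : a ≫ f = g ≫ u) (hbv : b ≫ f = g ≫ v)
    (μ : OrientationFamily) (hμ : μ.HasPoincareDuality)
    {q e : ℕ} (hqe : q + 2 * ((d + 1) + (d + 1)) = 2 * e + 2 * m) (w : complexBetti W q)
    {p q' : ℕ} (hpe : 2 * (p + 1) + 2 * e = 2 * p + 2 * (d + 1)) (hq' : 2 * p + q' = 2 * (d + 1))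
    (W' : complexBetti 𝒳 (2 * p)) (t s : ComplexPoints S) :
    complexBetti.map (fiberι f s) (2 * p)
      (corrClassAction (μ (hf.isSmoothProjective_total.tensor_holds hf.isSmoothProjective_total))
        (μ hf.isSmoothProjective_total) hpe hq'
        (complexGysin μ hW (hf.isSmoothProjective_total.tensor_holds hf.isSmoothProjective_total) (lift a b) hqe w)
        (fiberGysin hf t p (complexBetti.map (fiberι f t) (2 * p) W'))) = 0 := by
  -- `[𝒳_t] = f^* σ`
  obtain ⟨σ, hσ⟩ := exists_fiberClass_eq_map_base hf t
  have ha : complexBetti.map a (2 * (0 + 1))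
      (fiberGysin hf t 0 (singularCohomology.one ℂ (ComplexPoints (fiberOver f t)))) =
      complexBetti.map g (2 * (0 + 1)) (complexBetti.map u (2 * (0 + 1)) σ) := by
    rw [hσ, ← CategoryTheory.comp_apply, ← complexBetti.map_comp, hau, complexBetti.map_comp,
      CategoryTheory.comp_apply]
  have hb : complexBetti.map b (2 * (0 + 1))
      (fiberGysin hf t 0 (singularCohomology.one ℂ (ComplexPoints (fiberOver f t)))) =
      complexBetti.map g (2 * (0 + 1)) (complexBetti.map v (2 * (0 + 1)) σ) := by
    rw [hσ, ← CategoryTheory.comp_apply, ← complexBetti.map_comp, hbv, complexBetti.map_comp,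
      CategoryTheory.comp_apply]
  by_cases hu : complexBetti.map u (2 * (0 + 1)) σ = 0
  · -- first-vertical
    refine map_fiberι_corrClassAction_lift_eq_zero_of_map_fst_fiberClass_eq_zero hf hW a b μ hμ hqe w (t₀ := t) ?_
      hpe hq' _ s
    rw [ha, hu, map_zero]
  · -- `H²(C)` is a line: `v^* σ = c • u^* σ`
    obtain ⟨c, hc⟩ := exists_eq_smul_of_top complexOrientationFamily hC hu (complexBetti.map v (2 * (0 + 1)) σ)
    refine map_fiberι_corrClassAction_fiberGysin_eq_zero_of_map_fiberClass_propor hf hW a b μ hμ hqe w (t₀ := t)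
      (c := c) ?_ hpe hq' W' t s
    rw [hb, hc, map_smul, ← ha]

/-! ## §2 The sum step -/

/-- **A class with `j_s^* ∘ γ^* ∘ L_t = 0` identically is never a witness of a clause `p ≤ d`** (part XV-a:
`j_t^* ≠ 0` on `H²ᵖ(𝒳)` for `p ≤ d`). Any orientations. [cite: Abdulali1994FamiliesAV, Conjecture 5.3 and Theorem 5.5 (p. 1130)] -/
theorem not_fibreClassLefschetz_clause_of_forall_eq_zero {d : ℕ} {f : 𝒳 ⟶ S} (hf : IsCompactAbelianPencil f d)
    (μ : HomologicalOrientation ℂ (ComplexPoints (𝒳 ⊗ 𝒳)) (2 * ((d + 1) + (d + 1))))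
    (ν : HomologicalOrientation ℂ (ComplexPoints 𝒳) (2 * (d + 1)))
    {p e q : ℕ} (hab : 2 * (p + 1) + 2 * e = 2 * p + 2 * (d + 1)) (hq : 2 * p + q = 2 * (d + 1))
    (γ : complexBetti (𝒳 ⊗ 𝒳) (2 * e))
    (h0 : ∀ (W' : complexBetti 𝒳 (2 * p)) (t s : ComplexPoints S),
      complexBetti.map (fiberι f s) (2 * p)
        (corrClassAction μ ν hab hq γ (fiberGysin hf t p (complexBetti.map (fiberι f t) (2 * p) W'))) = 0)
    (hp : p ≤ d) :
    ¬ ∀ (W' : complexBetti 𝒳 (2 * p)) (t s : ComplexPoints S),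
        complexBetti.map (fiberι f s) (2 * p)
          (corrClassAction μ ν hab hq γ (fiberGysin hf t p (complexBetti.map (fiberι f t) (2 * p) W'))) =
          complexBetti.map (fiberι f s) (2 * p) W' := by
  obtain ⟨t₀⟩ : Nonempty (ComplexPoints S) := by
    haveI : IsIntegral S.left := IsSmoothProjective.isIntegral_holds hf.isSmoothProjective_base
    haveI : SmoothOfRelativeDimension 1 S.hom := hf.isSmoothProjective_base.smoothOfRelativeDimension
    haveI : Infinite (ComplexPoints S) := Motives.infinite_algPoints S
    infer_instance
  intro h
  obtain ⟨W', hW'⟩ := exists_map_fiberι_ne_zero hf hp t₀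
  exact hW' (by rw [← h W' t₀ t₀, h0])

/-- **The identity `j_s^* ∘ γ^* ∘ L_t = 0` is linear in `γ`**: if each `γᵢ` of a finite family satisfies it, so does
`Σᵢ γᵢ` (`corrClassAction` is linear in the correspondence). [cite: VoisinHodgeII2003, proof of Thm. 10.17 (10.7)] -/
theorem map_fiberι_corrClassAction_fiberGysin_sum_eq_zero {d : ℕ} {f : 𝒳 ⟶ S} (hf : IsCompactAbelianPencil f d)
    (μ : HomologicalOrientation ℂ (ComplexPoints (𝒳 ⊗ 𝒳)) (2 * ((d + 1) + (d + 1))))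
    (ν : HomologicalOrientation ℂ (ComplexPoints 𝒳) (2 * (d + 1)))
    {p e q : ℕ} (hab : 2 * (p + 1) + 2 * e = 2 * p + 2 * (d + 1)) (hq : 2 * p + q = 2 * (d + 1))
    {ι : Type*} (I : Finset ι) (γ : ι → complexBetti (𝒳 ⊗ 𝒳) (2 * e))
    (h0 : ∀ i ∈ I, ∀ (W' : complexBetti 𝒳 (2 * p)) (t s : ComplexPoints S),
      complexBetti.map (fiberι f s) (2 * p)
        (corrClassAction μ ν hab hq (γ i) (fiberGysin hf t p (complexBetti.map (fiberι f t) (2 * p) W'))) = 0)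
    (W' : complexBetti 𝒳 (2 * p)) (t s : ComplexPoints S) :
    complexBetti.map (fiberι f s) (2 * p)
      (corrClassAction μ ν hab hq (∑ i ∈ I, γ i) (fiberGysin hf t p (complexBetti.map (fiberι f t) (2 * p) W'))) =
      0 := by
  rw [map_sum, LinearMap.sum_apply, map_sum]
  exact Finset.sum_eq_zero fun i hi ↦ h0 i hi W' t s

/-- **A sum of classes each satisfying `j_s^* ∘ γᵢ^* ∘ L_t = 0` is never a witness of a clause `p ≤ d` of (β′_f).**
[cite: Abdulali1994FamiliesAV, Conjecture 5.3 and Theorem 5.5 (p. 1130)] -/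
theorem not_fibreClassLefschetz_clause_sum_of_forall_eq_zero {d : ℕ} {f : 𝒳 ⟶ S} (hf : IsCompactAbelianPencil f d)
    (μ : HomologicalOrientation ℂ (ComplexPoints (𝒳 ⊗ 𝒳)) (2 * ((d + 1) + (d + 1))))
    (ν : HomologicalOrientation ℂ (ComplexPoints 𝒳) (2 * (d + 1)))
    {p e q : ℕ} (hab : 2 * (p + 1) + 2 * e = 2 * p + 2 * (d + 1)) (hq : 2 * p + q = 2 * (d + 1))
    {ι : Type*} (I : Finset ι) (γ : ι → complexBetti (𝒳 ⊗ 𝒳) (2 * e))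
    (h0 : ∀ i ∈ I, ∀ (W' : complexBetti 𝒳 (2 * p)) (t s : ComplexPoints S),
      complexBetti.map (fiberι f s) (2 * p)
        (corrClassAction μ ν hab hq (γ i) (fiberGysin hf t p (complexBetti.map (fiberι f t) (2 * p) W'))) = 0)
    (hp : p ≤ d) :
    ¬ ∀ (W' : complexBetti 𝒳 (2 * p)) (t s : ComplexPoints S),
        complexBetti.map (fiberι f s) (2 * p)
          (corrClassAction μ ν hab hq (∑ i ∈ I, γ i)
            (fiberGysin hf t p (complexBetti.map (fiberι f t) (2 * p) W'))) =
          complexBetti.map (fiberι f s) (2 * p) W' :=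
  not_fibreClassLefschetz_clause_of_forall_eq_zero hf μ ν hab hq _
    (map_fiberι_corrClassAction_fiberGysin_sum_eq_zero hf μ ν hab hq I γ h0) hp

/-- **A SUM OF CORRESPONDENCES OVER CURVES OF `S × S` IS NEVER A WITNESS.** Let `f : 𝒳 ⟶ S` be a compact pencil of
abelian `d`-folds and `γ = Σ_{i ∈ I} (aᵢ, bᵢ)_* wᵢ ∈ H^{2e}((𝒳 ⊗ 𝒳)(ℂ); ℂ)` a finite sum of push-forward classes
from smooth projective `Wᵢ` (dimension `mᵢ`, `aᵢ, bᵢ : Wᵢ ⟶ 𝒳`, `wᵢ ∈ H^{qᵢ}(Wᵢ(ℂ); ℂ)`), such that EVERY base pair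
`(aᵢ ≫ f, bᵢ ≫ f)` factors through a smooth projective curve `Cᵢ`. Then for every `p ≤ d` the action `γ^*` in degrees
`2p + 2 → 2p` is not a witness of the degree-`p` clause of (β′_f): `j_s^* γ^* L_t = Σᵢ j_s^* γᵢ^* L_t = 0`, while
`j_t^* ≠ 0`. In words: a witness has a component whose base pair does not factor through a curve.
[cite: Abdulali1994FamiliesAV, Conjecture 5.3 and Theorem 5.5 (p. 1130)] [cite: Fulton1998, §19.1 Prop. 19.1.1 and Example 10.3.2]
[cite: Andre1996Motifs, §2.1 (p. 14) and Prop. 3.3 (p. 21)] -/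
theorem not_fibreClassLefschetz_clause_of_sum_factor_curve {d : ℕ} {f : 𝒳 ⟶ S} (hf : IsCompactAbelianPencil f d)
    {ι : Type*} (I : Finset ι) (V : ι → SchemeOver ℂ) (mV : ι → ℕ) (hV : ∀ i, IsSmoothProjective (mV i) (V i))
    (a b : ∀ i, V i ⟶ 𝒳) (C : ι → SchemeOver ℂ) (hC : ∀ i, IsSmoothProjective 1 (C i)) (g : ∀ i, V i ⟶ C i)
    (u v : ∀ i, C i ⟶ S) (hau : ∀ i, a i ≫ f = g i ≫ u i) (hbv : ∀ i, b i ≫ f = g i ≫ v i)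
    (μ : OrientationFamily) (hμ : μ.HasPoincareDuality) {e : ℕ} (qV : ι → ℕ)
    (hqe : ∀ i, qV i + 2 * ((d + 1) + (d + 1)) = 2 * e + 2 * mV i) (w : ∀ i, complexBetti (V i) (qV i))
    {p q' : ℕ} (hpe : 2 * (p + 1) + 2 * e = 2 * p + 2 * (d + 1)) (hq' : 2 * p + q' = 2 * (d + 1)) (hp : p ≤ d) :
    ¬ ∀ (W' : complexBetti 𝒳 (2 * p)) (t s : ComplexPoints S),
        complexBetti.map (fiberι f s) (2 * p)
          (corrClassAction (μ (hf.isSmoothProjective_total.tensor_holds hf.isSmoothProjective_total))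
            (μ hf.isSmoothProjective_total) hpe hq'
            (∑ i ∈ I, complexGysin μ (hV i) (hf.isSmoothProjective_total.tensor_holds hf.isSmoothProjective_total)
              (lift (a i) (b i)) (hqe i) (w i))
            (fiberGysin hf t p (complexBetti.map (fiberι f t) (2 * p) W'))) =
          complexBetti.map (fiberι f s) (2 * p) W' :=
  not_fibreClassLefschetz_clause_sum_of_forall_eq_zero hf _ _ hpe hq' I _
    (fun i _ W' t s ↦ map_fiberι_corrClassAction_fiberGysin_eq_zero_of_factor_curve hf (hV i) (a i) (b i) (hC i)
      (g i) (u i) (v i) (hau i) (hbv i) μ hμ (hqe i) (w i) hpe hq' W' t s) hp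

end Summit.HodgeConjecture.HodgeConjecture.Ring2.AbelianAll

end
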